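import Summits.QuantumFields.BalabanUV.Beta.EriceRemainderEnclosureHistoryAutonomyComparisonAgeCompositionSeparatedAges
import Summits.QuantumFields.BalabanUV.Beta.EriceRemainderEnclosureHistoryAutonomyComparisonAgeCompositionClusterCascade

/-!
# EriceRemainderEnclosureHistoryAutonomyComparisonAgeCompositionYoungPairSeparatedAges — (E95d) route (N), first order: A NEAR YOUNG PAIR BELOW A SEPARATED
# CHAIN OF ANY NUMBER OF OLDER AGES.  Profile carried by `{1, a_0, a_1, …, a_{r−1}}` with the young pair `{1, a_0}` NEAR (`2 ≤ a_0 ≤ 7`, resp. `≤ 19`)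
# and the older ages separated (`a_{j+1} ≥ 60·a_j`, resp. `≥ 87·a_j`): along EVERY admissible flow, for EVERY horizon and EVERY damping of the
# self-consistent class, `0 ≤ ε ≤ e` — for EVERY `r`.  The first flow instance of the CLUSTER cascade (E95c): level 0 is the pair `{1, a_0}` with the
# mass cap `x_1 + x_{a_0} ≤ √2∕(1 + p₀)` of (E92b) `pair_load_le_of_ratio` (`p₀⁴(a_0 + 1) ≤ 2`), the older levels are single ages with the own-window cap
# `0.6142` of (E94b) `load_le_of_sq` and the relative variation of (E95b) `old_read_variation_of_bound`

Cell `pub-balaban`, β-function sub-cell, BINDER row D4 «RemainderConst leaves for Bałaban's split» (`HOME/BINDER-OWNERS.md`; owner lineage `b2b-balaban-beta-an4`;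
this file by co-owner #2 lineage `b2b-balaban-beta-d4-p2`, generation 85), β-FLOW TEAM duty (1), FREEZE (0) honoured (def-free; nothing restated).

HONEST FRAMING (page 1, verbatim and binding).  *"Discharging BetaPertH makes Bałaban's UV stability UNCONDITIONAL — a real constructive-QFT result; it is
NOT the continuum limit and NOT the Clay problem."*  THIS FILE DISCHARGES NOTHING OF THE KIND.  Elementary real algebra ∕ real analysis about ABSTRACT
functionals on a box ]0,γ]^ℕ with displayed floors, profiles and signs, and the FIRST-ORDER renewal objects of route (N) built from them — hypotheses of a
census, not facts; the form, signs, ages and moments of Bałaban's (1.22) limit functional are NOT PRINTED ([I] p. 298; GAPS G-t4-U2-1∕-2) and NOT asserted.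
Row D4 class UNCHANGED (critical-path width 0; instance 0∕1; D4 DISCHARGE NO DATE).  HONEST DEPENDENCY: continuum YM on T⁴ ⇐ BetaPertH ∧ nine spine
estimates (0/9 proved); BetaPertH ⇐ (D1) ∧ (D4) ∧ CAP+tail; G-an2-4 gates asym, D1 and NE2/3/4.

THE POINT (README `HOME/b2b-balaban-beta-d4-p2/g85/README.md` §3).  In the cluster cascade the youngest level needs only a window and a MASS CAP `s₀` with
`s₀(1+κ) ≤ 1`; the pair `{1, a_0}` has `x_1 + x_{a_0} ≤ √2∕(1+p₀)` whenever `p₀⁴(a_0+1) ≤ 2`, so `κ = 1∕5`, `p₀ = 7∕10` serve `a_0 ≤ 7` (`√2·6∕5 ≤ 17∕10`,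
closure `1∕5 + 4·0.6142·6∕5 = 3.148 ≤ 60·0.26296·1∕5 = 3.156` at `R₀ = 60`) and `κ = 1∕10`, `p₀ = 14∕25` serve `a_0 ≤ 19` (`R₀ = 87`).  Uses (E95c)
`renewal_nonneg_cluster_cascade`, (E95b) `old_read_variation_of_bound`∕`aggregate_eq_sum_ages`, (E94b) `load_le_of_sq`, (E92b) `pair_load_le_of_ratio`, (E82a)
`kernel_entry_le`∕`row_mass_le` BY NAME.  NOT CLAIMED: young pairs `{1, a_0}` with `a_0 ≥ 20` under a separated chain closer than `×58` of (E95b) (for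
`a_0 ≥ 58` (E95b) applies); near pairs among the OLDER ages; anything nonlinear; anything printed — NOT B12 Thm 2, NOT BetaPertH, NOT continuum, NOT Clay.

WHAT IS PROVED ([folklore]; 0 `def`, 0 sorry).  **`flow_nonneg_young_pair_separated_ages_param`** (parametric `κ, p₀, R₀`), **`flow_nonneg_young_pair_separated_ages`**
(`2 ≤ a_0 ≤ 7`, ratio `60`), **`flow_nonneg_young_pair_separated_ages_wide`** (`2 ≤ a_0 ≤ 19`, ratio `87`), `flow_nonneg_census_four_ages_young_pair`
(`{1, k₂, k₃, k₄}`, `2 ≤ k₂ ≤ 7`, `k₃ ≥ 60k₂`, `k₄ ≥ 60k₃`).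
-/
noncomputable section
open Finset

namespace Summit.QuantumFields.BalabanUV.Beta.EriceRemainderEnclosureHistoryAutonomyComparisonAgeCompositionYoungPairSeparatedAges

open Literature.MathematicalPhysics.QuantumFieldTheory.Balaban1983to89
open Literature.MathematicalPhysics.QuantumFieldTheory.Balaban1983to89.T4BetaStationary
open Literature.MathematicalPhysics.QuantumFieldTheory.Balaban1983to89.T4BetaFlowWellPosed
open Summit.QuantumFields.BalabanUV.Beta.EriceRemainderEnclosureHistoryAutonomyComparisonAgeCompositionYoungPairMoment (load_le_of_sq)
open Summit.QuantumFields.BalabanUV.Beta.EriceRemainderEnclosureHistoryAutonomyComparisonAgeCompositionPairShares (pair_load_le_of_ratio)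
open Summit.QuantumFields.BalabanUV.Beta.EriceRemainderEnclosureHistoryAutonomyComparisonAgeCompositionYoungestTailSumFlow
  (kernel_entry_le row_mass_le)
open Summit.QuantumFields.BalabanUV.Beta.EriceRemainderEnclosureHistoryAutonomyComparisonAgeCompositionSeparatedAges
  (old_read_variation_of_bound aggregate_eq_sum_ages)
open Summit.QuantumFields.BalabanUV.Beta.EriceRemainderEnclosureHistoryAutonomyComparisonAgeCompositionClusterCascade
  (renewal_nonneg_cluster_cascade)

variable {B : (ℕ → ℝ) → ℝ} {γ b gIR : ℝ} {L : ℕ → ℝ} {K : ℕ} {h g : ℕ → ℝ}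

/-- **A NEAR YOUNG PAIR BELOW A SEPARATED CHAIN — PARAMETRIC FORM.**  `B` an isotone memory on the box with floor `b > 0` dominating the profile `L ≥ 0`
carried by `{1, a 0, a 1, …, a (r−1)}` (`r ≥ 1`, `2 ≤ a 0`, `a (r−1) < K`, `R₀·a j ≤ a (j+1)`, `R₀ ≥ 28`, `L l = 0` for the other `l < K`); `h` a box
solution; dampings `0 < g ≤ 1` with `g_t(1 + F_t) ≥ 1`; kernels `KL`, aggregates `KA`, reads `RA`; `e ≥ 0` non-increasing; `ε` the first-order comparison
solution with zero tail beyond `N`.  Parameters: `κ > 0` with `0.6142·(1+κ) < 1` and the closure `κ + 4·0.6142·(1+κ) ≤ R₀·(1 − 0.6142(1+κ))·κ`; `p₀ ≥ 0`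
with `p₀⁴·(a 0 + 1) ≤ 2` and `√2∕(1+p₀)·(1+κ) ≤ 1`.  THEN `0 ≤ ε ≤ e` at every pin ((E95c) `renewal_nonneg_cluster_cascade`: level `0` = the pair
`{1, a 0}`, levels `j ≥ 1` = the ages `a j`). [folklore] -/
theorem flow_nonneg_young_pair_separated_ages_param
    (hmono : ∀ u v : ℕ → ℝ, SeqBox γ u → SeqBox γ v → (∀ j, u j ≤ v j) → B u ≤ B v)
    (hL : ∀ k, 0 ≤ L k) (hb : 0 < b) (hlo : ∀ u, SeqBox γ u → b ≤ B u) (hdom : ∀ u, SeqBox γ u → ∑ k ∈ range K, L k * u k ≤ B u)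
    (hh : SeqBox γ h) (hf : MemFlow B gIR h) (hg : ∀ t, 0 < g t ∧ g t ≤ 1)
    (hgF : ∀ t, 1 ≤ g t * (1 + ∑ k ∈ range K, L k * h (t + k) ^ 3 / 2))
    {κ p₀ : ℝ} {R₀ : ℕ} (hκ : 0 < κ) (hsC : (6142 / 10000 : ℝ) * (1 + κ) < 1)
    (hR : κ + 4 * (6142 / 10000 : ℝ) * (1 + κ) ≤ (R₀ : ℝ) * (1 - (6142 / 10000 : ℝ) * (1 + κ)) * κ) (hR28 : 28 ≤ R₀)
    (hp0 : 0 ≤ p₀) (hs₀C : Real.sqrt 2 / (1 + p₀) * (1 + κ) ≤ 1)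
    {r : ℕ} {a : ℕ → ℕ} (hr : 1 ≤ r) (ha0 : 2 ≤ a 0) (hp : p₀ ^ 4 * ((a 0 : ℝ) + 1) ≤ 2) (haK : a (r - 1) < K)
    (hsep : ∀ j, j + 1 < r → R₀ * a j ≤ a (j + 1)) (hLa : ∀ l, l < K → l ≠ 1 → (∀ j, j < r → l ≠ a j) → L l = 0)
    {N : ℕ} {KL : ℕ → ℕ → ℕ → ℝ}
    (hKL : ∀ k n l, KL k n l = if 0 < k ∧ k < K ∧ l < k then L k * h (n + k) ^ 3 / 2 * ∏ t ∈ Ico (n + 1 + l) (n + k + 1), g t else 0)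
    {KA : ℕ → ℕ → ℕ → ℝ} {RA : ℕ → (ℕ → ℝ) → ℕ → ℝ}
    (hRA : ∀ i v m, RA i v m = ∑ l ∈ range K, KA i m l * v (m + 1 + l))
    (hKA : ∀ i m l, KA i m l = KL i m l + KA (i + 1) m l) (hKAtop : ∀ m l, KA K m l = 0)
    {e ε : ℕ → ℝ} (he0 : ∀ m, 0 ≤ e m) (hea : ∀ m, e (m + 1) ≤ e m)
    (hεt : ∀ m, N < m → ε m = 0) (hεrec : ∀ m, ε m = e m - RA 1 ε m) : ∀ m, 0 ≤ ε m ∧ ε m ≤ e m := by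
  have hpos : ∀ n, 0 < h n := fun n => (hh n).1
  have hR1 : 1 ≤ R₀ := by omega
  -- the chain of older ages: monotone, strictly increasing, below K, ≥ 56 from level 1 on
  have hamono : ∀ i j, i ≤ j → j < r → a i ≤ a j := by
    intro i j hij hjr
    induction j, hij using Nat.le_induction with
    | base => exact le_rfl
    | succ j _ ih =>
      have h1 := ih (by omega); have h2 := hsep j hjr
      have h3 : a j ≤ R₀ * a j := Nat.le_mul_of_pos_left _ (by omega)
      omega
  have hapos : ∀ j, j < r → 2 ≤ a j := fun j hj => ha0.trans (hamono 0 j (Nat.zero_le j) hj)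
  have hastrict : ∀ i j, i < j → j < r → a i < a j := by
    intro i j hij hjr
    have h1 := hamono i (j - 1) (by omega) (by omega)
    have h2 := hsep (j - 1) (by omega)
    have h3 := hapos (j - 1) (by omega)
    rw [Nat.sub_add_cancel (by omega)] at h2
    have h4 : a (j - 1) < R₀ * a (j - 1) := by nlinarith
    omega
  have hajK : ∀ j, j < r → a j < K := fun j hj => lt_of_le_of_lt (hamono j (r - 1) (by omega) (by omega)) haK
  have haold : ∀ j, 1 ≤ j → j < r → 56 ≤ a j := by
    intro j hj hjr
    have h2 := hsep (j - 1) (by omega)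
    have h3 := hapos (j - 1) (by omega)
    rw [Nat.sub_add_cancel hj] at h2
    nlinarith
  have hainj : ∀ i j, i < r → j < r → a i = a j → i = j := by
    intro i j hi hj hij
    by_contra hne
    rcases Nat.lt_or_gt_of_ne hne with h' | h'
    · exact absurd hij (ne_of_lt (hastrict i j h' hj))
    · exact absurd hij.symm (ne_of_lt (hastrict j i h' hi))
  have hK : 1 < K := by have := hajK 0 (by omega); have := hapos 0 (by omega); omega
  have hL0 : L 0 = 0 := hLa 0 (by omega) (by omega) fun j hj h0 => by have := hapos j hj; omega
  -- the extended age map: 1, a 0, a 1, …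
  obtain ⟨at', hat'⟩ : ∃ at' : ℕ → ℕ, ∀ i, at' i = if i = 0 then 1 else a (i - 1) := ⟨_, fun _ => rfl⟩
  have hat0 : at' 0 = 1 := by rw [hat']; simp
  have hatS : ∀ j, at' (j + 1) = a j := fun j => by rw [hat']; simp
  have hagg : ∀ q l, KA 1 q l = KL 1 q l + ∑ j ∈ range r, KL (a j) q l := by
    intro q l
    have h1 := aggregate_eq_sum_ages (L := L) (h := h) (g := g) hKL hKA hKAtop hK.le (r := r + 1) (a := at')
      (fun i hi => by
        rcases Nat.eq_zero_or_pos i with rfl | hip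
        · rw [hat0]; exact ⟨Nat.one_pos, hK⟩
        · obtain ⟨j, rfl⟩ : ∃ j, i = j + 1 := ⟨i - 1, by omega⟩
          rw [hatS]; exact ⟨by have := hapos j (by omega); omega, hajK j (by omega)⟩)
      (fun i i' hi hi' hii' => by
        rcases Nat.eq_zero_or_pos i with rfl | hip <;> rcases Nat.eq_zero_or_pos i' with rfl | hip'
        · rfl
        · obtain ⟨j', rfl⟩ : ∃ j', i' = j' + 1 := ⟨i' - 1, by omega⟩
          rw [hat0, hatS] at hii'; have := hapos j' (by omega); omega
        · obtain ⟨j, rfl⟩ : ∃ j, i = j + 1 := ⟨i - 1, by omega⟩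
          rw [hat0, hatS] at hii'; have := hapos j (by omega); omega
        · obtain ⟨j, rfl⟩ : ∃ j, i = j + 1 := ⟨i - 1, by omega⟩
          obtain ⟨j', rfl⟩ : ∃ j', i' = j' + 1 := ⟨i' - 1, by omega⟩
          rw [hatS, hatS] at hii'
          rw [hainj j j' (by omega) (by omega) hii'])
      (fun l' hl' hne => hLa l' hl' (by have := hne 0 (by omega); rwa [hat0] at this)
        (fun j hj => by have := hne (j + 1) (by omega); rwa [hatS] at this)) q l
    rw [h1, sum_range_succ']
    simp only [hatS, hat0]
    ring
  -- level data: level 0 = the pair {1, a 0}; level j ≥ 1 = the age a j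
  obtain ⟨w, hw⟩ : ∃ w : ℕ → ℕ → ℕ → ℝ, ∀ j q l, w j q l = KL (a j) q l + if j = 0 then KL 1 q l else 0 := ⟨_, fun _ _ _ => rfl⟩
  obtain ⟨x, hx⟩ : ∃ x : ℕ → ℕ → ℝ, ∀ j q, x j q = (a j : ℝ) * (L (a j) * h (q + a j) ^ 3 / 2)
      + if j = 0 then (1 : ℝ) * (L 1 * h (q + 1) ^ 3 / 2) else 0 := ⟨_, fun _ _ => rfl⟩
  obtain ⟨O, hO⟩ : ∃ O : ℕ → ℕ → ℝ, ∀ j q, O j q = ∑ l ∈ range K, w j q l * ε (q + 1 + l) := ⟨_, fun _ _ => rfl⟩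
  have hc0 : ∀ k q, 0 ≤ L k * h (q + k) ^ 3 / 2 := fun k q => by have := hL k; have := hpos (q + k); positivity
  -- the recursion with the level reads displayed
  have hrec : ∀ q, ε q = e q - ∑ j ∈ range r, O j q := by
    intro q
    rw [hεrec q, hRA]
    have h1 : ∑ j ∈ range r, O j q = ∑ l ∈ range K, (∑ j ∈ range r, w j q l) * ε (q + 1 + l) := by
      simp_rw [hO, sum_mul]; rw [sum_comm]
    have h2 : ∀ l, ∑ j ∈ range r, w j q l = KA 1 q l := by
      intro l
      simp_rw [hw, sum_add_distrib, sum_ite_eq' (range r) 0, if_pos (mem_range.mpr (by omega : 0 < r))]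
      rw [hagg]; ring
    rw [h1]
    simp_rw [h2]
  refine renewal_nonneg_cluster_cascade (r := r) (N := N) (Kw := K) (R₀ := R₀) (κ := κ) (s₀ := Real.sqrt 2 / (1 + p₀))
    (s := 6142 / 10000) (lo := fun j => if j = 0 then 1 else a j) (hi := a) (w := w) (x := x)
    (ν := fun j q => 4 * (L (a j) * h (q + a j) ^ 3 / 2)) (O := O) (e := e) (ε := ε)
    hκ (by norm_num) hs₀C hsC hR (fun j hj => ?_) (fun j hj1 _ => by simp [if_neg (by omega : j ≠ 0)])
    (fun j q l => ?_) (fun j q l hl => ?_) (fun j q => ?_) (fun j q => by have := hc0 (a j) q; positivity)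
    (fun j q hj => ?_) (fun q => ?_) (fun j q hj1 hjr => ?_) (fun j q hj1 _ => ?_) hO
    (fun j m d T hj1 hjr hd1 hdj hT hnn hle => ?_) he0 hea hεt hrec
  · -- separation R₀·hi j ≤ lo (j+1) = a (j+1)
    simp only [if_neg (Nat.succ_ne_zero j)]
    exact hsep j hj
  · -- weights are non-negative
    rw [hw]
    refine add_nonneg (kernel_entry_le hL hh hg hKL (a j) q l).1 ?_
    split_ifs
    · exact (kernel_entry_le hL hh hg hKL 1 q l).1
    · exact le_rfl
  · -- weights vanish beyond the window a j
    rw [hw, hKL (a j), if_neg (by omega)]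
    split_ifs with hj
    · rw [hKL, if_neg (by have := hapos 0 (by omega); subst hj; omega)]; simp
    · simp
  · -- masses are non-negative
    rw [hx]
    refine add_nonneg (mul_nonneg (Nat.cast_nonneg _) (hc0 _ _)) ?_
    split_ifs
    · rw [one_mul]; exact hc0 1 q
    · exact le_rfl
  · -- row sums ≤ mass
    rw [hx]
    simp_rw [hw, sum_add_distrib]
    refine add_le_add (row_mass_le hL hh hg hKL (hajK j hj) q) ?_
    split_ifs
    · simpa using row_mass_le hL hh hg hKL hK q
    · simp
  · -- the young pair's mass cap √2∕(1+p₀)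
    rw [hx, if_pos rfl]
    have hpair := pair_load_le_of_ratio hmono hL hb hlo hdom hh hf (j := 1) (k := a 0) le_rfl (by have := hapos 0 (by omega); omega)
      (hajK 0 (by omega)) hp0 (by push_cast; linarith) q
    simpa [add_comm] using hpair
  · -- the older caps: 3k + 1 ≤ 8k·0.6142² for k ≥ 56
    rw [hx, if_neg (by omega), add_zero]
    have hk56 : (56 : ℝ) ≤ a j := by exact_mod_cast haold j hj1 hjr
    exact load_le_of_sq hmono hL hb hlo hdom hh hf (by have := hapos j hjr; omega) (hajK j hjr) (by norm_num) (by nlinarith) q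
  · -- lo·ν ≤ 4x for the older levels
    rw [hx]
    simp only [if_neg (show j ≠ 0 by omega), add_zero]
    nlinarith [hc0 (a j) q]
  · -- the relative variation of the read of the age a j (j ≥ 1)
    have hO' : ∀ q, O j q = ∑ l ∈ range K, KL (a j) q l * ε (q + 1 + l) := fun q => by
      rw [hO]; exact sum_congr rfl fun l _ => by rw [hw, if_neg (by omega), add_zero]
    rw [hO', hO']
    simp only [if_neg (by omega : j ≠ 0)] at hdj
    have hv := old_read_variation_of_bound hmono hL hb hlo hdom hh hf hL0 hg hgF hKL (by have := hapos j hjr; omega) (hajK j hjr)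
      hd1 hdj hT hnn hle
    have e1 : 4 * (d : ℝ) * (L (a j) * h (m + a j) ^ 3 / 2) * T = 4 * (L (a j) * h (m + a j) ^ 3 / 2) * d * T := by ring
    simpa only [e1] using hv

/-- **THE YOUNG PAIR `{1, k₂}` WITH `2 ≤ k₂ ≤ 7` BELOW A CHAIN SEPARATED BY `×60`, ANY NUMBER OF AGES** (`κ = 1∕5`, `p₀ = 7∕10`). [folklore] -/
theorem flow_nonneg_young_pair_separated_ages
    (hmono : ∀ u v : ℕ → ℝ, SeqBox γ u → SeqBox γ v → (∀ j, u j ≤ v j) → B u ≤ B v)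
    (hL : ∀ k, 0 ≤ L k) (hb : 0 < b) (hlo : ∀ u, SeqBox γ u → b ≤ B u) (hdom : ∀ u, SeqBox γ u → ∑ k ∈ range K, L k * u k ≤ B u)
    (hh : SeqBox γ h) (hf : MemFlow B gIR h) (hg : ∀ t, 0 < g t ∧ g t ≤ 1)
    (hgF : ∀ t, 1 ≤ g t * (1 + ∑ k ∈ range K, L k * h (t + k) ^ 3 / 2))
    {r : ℕ} {a : ℕ → ℕ} (hr : 1 ≤ r) (ha0 : 2 ≤ a 0) (ha7 : a 0 ≤ 7) (haK : a (r - 1) < K)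
    (hsep : ∀ j, j + 1 < r → 60 * a j ≤ a (j + 1)) (hLa : ∀ l, l < K → l ≠ 1 → (∀ j, j < r → l ≠ a j) → L l = 0)
    {N : ℕ} {KL : ℕ → ℕ → ℕ → ℝ}
    (hKL : ∀ k n l, KL k n l = if 0 < k ∧ k < K ∧ l < k then L k * h (n + k) ^ 3 / 2 * ∏ t ∈ Ico (n + 1 + l) (n + k + 1), g t else 0)
    {KA : ℕ → ℕ → ℕ → ℝ} {RA : ℕ → (ℕ → ℝ) → ℕ → ℝ}
    (hRA : ∀ i v m, RA i v m = ∑ l ∈ range K, KA i m l * v (m + 1 + l))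
    (hKA : ∀ i m l, KA i m l = KL i m l + KA (i + 1) m l) (hKAtop : ∀ m l, KA K m l = 0)
    {e ε : ℕ → ℝ} (he0 : ∀ m, 0 ≤ e m) (hea : ∀ m, e (m + 1) ≤ e m)
    (hεt : ∀ m, N < m → ε m = 0) (hεrec : ∀ m, ε m = e m - RA 1 ε m) : ∀ m, 0 ≤ ε m ∧ ε m ≤ e m := by
  have hs : Real.sqrt 2 ≤ 17 / 12 := Real.sqrt_le_iff.mpr ⟨by norm_num, by norm_num⟩
  have ha7' : (a 0 : ℝ) ≤ 7 := by exact_mod_cast ha7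
  refine flow_nonneg_young_pair_separated_ages_param hmono hL hb hlo hdom hh hf hg hgF (κ := 1 / 5) (p₀ := 7 / 10) (R₀ := 60)
    (by norm_num) (by norm_num) (by norm_num) (by norm_num) (by norm_num) ?_ hr ha0 (by nlinarith) haK hsep hLa hKL hRA hKA hKAtop
    he0 hea hεt hεrec
  rw [div_mul_eq_mul_div, div_le_one (by norm_num)]
  linarith

/-- **THE YOUNG PAIR `{1, k₂}` WITH `2 ≤ k₂ ≤ 19` BELOW A CHAIN SEPARATED BY `×87`, ANY NUMBER OF AGES** (`κ = 1∕10`, `p₀ = 14∕25`). [folklore] -/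
theorem flow_nonneg_young_pair_separated_ages_wide
    (hmono : ∀ u v : ℕ → ℝ, SeqBox γ u → SeqBox γ v → (∀ j, u j ≤ v j) → B u ≤ B v)
    (hL : ∀ k, 0 ≤ L k) (hb : 0 < b) (hlo : ∀ u, SeqBox γ u → b ≤ B u) (hdom : ∀ u, SeqBox γ u → ∑ k ∈ range K, L k * u k ≤ B u)
    (hh : SeqBox γ h) (hf : MemFlow B gIR h) (hg : ∀ t, 0 < g t ∧ g t ≤ 1)
    (hgF : ∀ t, 1 ≤ g t * (1 + ∑ k ∈ range K, L k * h (t + k) ^ 3 / 2))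
    {r : ℕ} {a : ℕ → ℕ} (hr : 1 ≤ r) (ha0 : 2 ≤ a 0) (ha19 : a 0 ≤ 19) (haK : a (r - 1) < K)
    (hsep : ∀ j, j + 1 < r → 87 * a j ≤ a (j + 1)) (hLa : ∀ l, l < K → l ≠ 1 → (∀ j, j < r → l ≠ a j) → L l = 0)
    {N : ℕ} {KL : ℕ → ℕ → ℕ → ℝ}
    (hKL : ∀ k n l, KL k n l = if 0 < k ∧ k < K ∧ l < k then L k * h (n + k) ^ 3 / 2 * ∏ t ∈ Ico (n + 1 + l) (n + k + 1), g t else 0)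
    {KA : ℕ → ℕ → ℕ → ℝ} {RA : ℕ → (ℕ → ℝ) → ℕ → ℝ}
    (hRA : ∀ i v m, RA i v m = ∑ l ∈ range K, KA i m l * v (m + 1 + l))
    (hKA : ∀ i m l, KA i m l = KL i m l + KA (i + 1) m l) (hKAtop : ∀ m l, KA K m l = 0)
    {e ε : ℕ → ℝ} (he0 : ∀ m, 0 ≤ e m) (hea : ∀ m, e (m + 1) ≤ e m)
    (hεt : ∀ m, N < m → ε m = 0) (hεrec : ∀ m, ε m = e m - RA 1 ε m) : ∀ m, 0 ≤ ε m ∧ ε m ≤ e m := by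
  have hs : Real.sqrt 2 ≤ 78 / 55 := Real.sqrt_le_iff.mpr ⟨by norm_num, by norm_num⟩
  have ha19' : (a 0 : ℝ) ≤ 19 := by exact_mod_cast ha19
  refine flow_nonneg_young_pair_separated_ages_param hmono hL hb hlo hdom hh hf hg hgF (κ := 1 / 10) (p₀ := 14 / 25) (R₀ := 87)
    (by norm_num) (by norm_num) (by norm_num) (by norm_num) (by norm_num) ?_ hr ha0 (by nlinarith) haK hsep hLa hKL hRA hKA hKAtop
    he0 hea hεt hεrec
  rw [div_mul_eq_mul_div, div_le_one (by norm_num)]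
  linarith

/-- **THE CENSUS FOUR AGES `{1, k₂, k₃, k₄}` WITH A NEAR YOUNG PAIR** (`2 ≤ k₂ ≤ 7`, `k₃ ≥ 60k₂`, `k₄ ≥ 60k₃`, `k₄ < K`): `0 ≤ ε ≤ e` at every pin, every
horizon, every damping of the self-consistent class. [folklore] -/
theorem flow_nonneg_census_four_ages_young_pair
    (hmono : ∀ u v : ℕ → ℝ, SeqBox γ u → SeqBox γ v → (∀ j, u j ≤ v j) → B u ≤ B v)
    (hL : ∀ k, 0 ≤ L k) (hb : 0 < b) (hlo : ∀ u, SeqBox γ u → b ≤ B u) (hdom : ∀ u, SeqBox γ u → ∑ k ∈ range K, L k * u k ≤ B u)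
    (hh : SeqBox γ h) (hf : MemFlow B gIR h) (hg : ∀ t, 0 < g t ∧ g t ≤ 1)
    (hgF : ∀ t, 1 ≤ g t * (1 + ∑ k ∈ range K, L k * h (t + k) ^ 3 / 2))
    {k₂ k₃ k₄ : ℕ} (hk2 : 2 ≤ k₂) (hk27 : k₂ ≤ 7) (hk3 : 60 * k₂ ≤ k₃) (hk4 : 60 * k₃ ≤ k₄) (hk4K : k₄ < K)
    (hL4 : ∀ j, j < K → j ≠ 1 → j ≠ k₂ → j ≠ k₃ → j ≠ k₄ → L j = 0)
    {N : ℕ} {KL : ℕ → ℕ → ℕ → ℝ}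
    (hKL : ∀ k n l, KL k n l = if 0 < k ∧ k < K ∧ l < k then L k * h (n + k) ^ 3 / 2 * ∏ t ∈ Ico (n + 1 + l) (n + k + 1), g t else 0)
    {KA : ℕ → ℕ → ℕ → ℝ} {RA : ℕ → (ℕ → ℝ) → ℕ → ℝ}
    (hRA : ∀ i v m, RA i v m = ∑ l ∈ range K, KA i m l * v (m + 1 + l))
    (hKA : ∀ i m l, KA i m l = KL i m l + KA (i + 1) m l) (hKAtop : ∀ m l, KA K m l = 0)
    {e ε : ℕ → ℝ} (he0 : ∀ m, 0 ≤ e m) (hea : ∀ m, e (m + 1) ≤ e m)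
    (hεt : ∀ m, N < m → ε m = 0) (hεrec : ∀ m, ε m = e m - RA 1 ε m) : ∀ m, 0 ≤ ε m ∧ ε m ≤ e m := by
  refine flow_nonneg_young_pair_separated_ages hmono hL hb hlo hdom hh hf hg hgF (r := 3)
    (a := fun j => if j = 0 then k₂ else if j = 1 then k₃ else k₄) (by norm_num) (by simpa using hk2) (by simpa using hk27)
    (by simpa using hk4K) (fun j hj => ?_) (fun l hl hl1 hla => hL4 l hl hl1 ?_ ?_ ?_) hKL hRA hKA hKAtop he0 hea hεt hεrec
  · have : j = 0 ∨ j = 1 := by omega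
    rcases this with rfl | rfl <;> simp <;> omega
  · simpa using hla 0 (by norm_num)
  · simpa using hla 1 (by norm_num)
  · simpa using hla 2 (by norm_num)

end Summit.QuantumFields.BalabanUV.Beta.EriceRemainderEnclosureHistoryAutonomyComparisonAgeCompositionYoungPairSeparatedAges

end
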